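import Summits.ResolutionOfSingularities.ResolutionOfSingularities.Theorems.MarkedTransferCampaignW46HostSurfaces
import Literature.AlgebraicGeometry.Resolution.MarkedCurveOrderReduction
import HarnessLib

/-!
# [OURS · L1 W4.6 rung (i) SURFACES, host words] The surface rung AT THE DATA LEVEL: a `CentreSeq` resolving an effective
# Cartier marked ideal `(I, E, m)` on a regular surface (every field)

Cell res-hironaka, LADDER-RESOLUTION rung L (D-0089), slot W4.6 «restricted regimes as rungs», rung (i) SURFACES; seat res-L1-s46-pv-1
(gen 7). Gen 6 of this seat closed the surface rung of res-L1-type-o1's host ladder, `CampaignW46.hypersurfaceOrderReductionDimLE_two`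
(`…W46HostSurfaces.lean`, p557305): a BGMW marked resolution `∃ X′ Φ M′, IsMarkedResolution ⟨I, E, m⟩ Φ M′` of an effective Cartier
marked ideal on a regular surface, as a `Prop`-level multiple blow-up. THIS FILE re-exports the same construction AT THE DATA LEVEL
of the tree's `CentreSeq` (`CentreSeq.IsResolutionOf`: the dependent list of the successive centres, BGMW Def. 3.1.4 as data), which is
the currency of the tree's restriction / extension / boundary calculus (`BlowupSequencesExtendOpen`, `BoundaryEquivalence`, …) and the
input form of the sequel `…W46MarkedSurfaces.lean` (marked order reduction for EVERY ideal sheaf on a surface, where this file is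
applied on the open complement of the finitely many base points of the codimension-two part). Proposed `--kind proof --supports`
stmt-ResolutionOfSingularities-16156 `--as helper`. Everything is OURS; nothing here is a statement of H. Hironaka's manuscript
[Hironaka2017]; no typed `Hironaka2017` candidate and no named FACT enters. AI-written; AI review is weaker than expert review.

## What is proved (all `CentreSeq`-level twins of gen 6's `Prop`-level theorems; same proofs, same tree bricks)

* `exists_isResolutionOf_of_isResolutionOf_opens` — a data-level resolution of `M|_U` on an open `U ⊇ supp M` (`supp M` closed,
  boundary snc) extends to a data-level resolution of `M` (tree `CentreSeq.exists_extend_of_centresOver`; any dimension).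
* `exists_isResolutionOf_of_sncAt_nhds` — the snc END-GAME (any dimension): `I` effective Cartier, `Supp(I · ∏E)` snc near
  `Sing(I, m)` ⟹ `∃ t : CentreSeq X, t.IsResolutionOf ⟨I, E, m⟩` (Kollár's monomial resolution + boundary equivalence + extension).
* `exists_isResolutionOf_of_family` — THE SURFACE LOOP of gen 6 (pv-11's measure on the prime-divisor family of `V(I · ∏E)`), now
  prepending the chosen blow-up `blowup.π P` with `CentreSeq.cons`.
* `exists_isResolutionOf_of_dim_le_one` — curves: every marked ideal `(I, E, m)`, `I ≠ 0` ANY ideal, on a regular integral Noetherian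
  scheme of dimension `≤ 1` has a data-level resolution (res-L1-s46-pv-7's `exists_isResolutionOf_of_ringKrullDim_le_one`).
* **`exists_isResolutionOf_of_isEffectiveCartier`** — `X` integral Noetherian regular, locally of finite type over a field `k`,
  `topologicalKrullDim X ≤ 2`, `I ≠ 0` effective Cartier, `E` snc, `m ≥ 1` ⟹ `∃ t : CentreSeq X, t.IsResolutionOf ⟨I, E, m⟩`.

## Sources

* R. Hartshorne, *Algebraic Geometry* (1977), Ch. V Thm. 3.9 (embedded resolution of curves in surfaces). [Hartshorne1977]
* J. Kollár, *Lectures on Resolution of Singularities* (2007), Thm. 3.105 (proof), (3.111) Step 3. [Kollar2007]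
* E. Bierstone, D. Grigoriev, P. Milman, J. Włodarczyk, arXiv:1206.3090, Def. 3.1.3–3.1.5, Thm. 8.0.5 (2).
  [BierstoneGrigorievMilmanWlodarczyk2011]
* H. Hironaka, ms. 2017-03-23 — scope only (the `d = 2` rung of the campaign's host ladder), under adjudication, not cited as fact.
  [Hironaka2017]
-/

noncomputable section

set_option linter.dupNamespace false -- mandated namespace of this single-conjunct summit

open CategoryTheory AlgebraicGeometry TopologicalSpace IsLocalRing

namespace Summit.ResolutionOfSingularities.ResolutionOfSingularities.Theorems

namespace CampaignW46

open Literature.AlgebraicGeometry.Resolution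
open Literature.AlgebraicGeometry.Hironaka2017
open Scheme.IdealSheafData

universe u

/-! ## §0 Extension from an open neighbourhood of the support, at the data level -/

/-- **A DATA-LEVEL RESOLUTION MAY BE BUILT ON AN OPEN NEIGHBOURHOOD OF THE (CLOSED) SUPPORT.** `X` locally Noetherian,
`M = (X, I, E, μ)` a marked ideal with `E` snc and `supp M` closed, `U ⊆ X` open with `supp M ⊆ U`; a data-level resolution `s` of
`M|_U` (`CentreSeq.IsResolutionOf`) yields a data-level resolution of `M`: the centres of `s` lie over `supp M` (tree
`IsAdmissibleFor.centresOver_support`), so `s` extends to a multiple blow-up `t` of `M` with the same centres (tree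
`CentreSeq.exists_extend_of_centresOver`); the final support along `t` lies over `supp M ⊆ U` and misses the preimage of `U`, so it is
empty. Any dimension. (The `Prop`-level form is gen 6's `exists_isMarkedResolution_of_isResolutionOf_opens`.)
[cite: BierstoneGrigorievMilmanWlodarczyk2011, Def. 3.1.5 Remark (1), Thm. 8.0.5 (2)] [cite: Kollar2007, Thm. 3.105 (proof)] -/
theorem exists_isResolutionOf_of_isResolutionOf_opens {X : Scheme.{u}} [IsLocallyNoetherian X] (M : MarkedIdeal X)
    (hE : HasSNC M.boundary) (hclosed : IsClosed M.support) (U : X.Opens) (hU : M.support ⊆ (U : Set X))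
    {s : CentreSeq (U : Scheme.{u})} (hs : s.IsResolutionOf (M.comap U.ι)) :
    ∃ t : CentreSeq X, t.IsResolutionOf M := by
  haveI : IsLocallyNoetherian (U : Scheme.{u}) := LocallyOfFiniteType.isLocallyNoetherian U.ι
  have hrange : M.support ⊆ Set.range U.ι := by rw [Scheme.Opens.range_ι]; exact hU
  have hover : s.CentresOver (U.ι ⁻¹' M.support) := by
    have h := CentreSeq.IsAdmissibleFor.centresOver_support s _ hs.1
    rwa [MarkedIdeal.support_comap_of_isOpenImmersion] at h
  obtain ⟨t, htadm, -, hpb⟩ := CentreSeq.exists_extend_of_centresOver s U.ι M M.support hclosed hrange hE hs.1 hover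
  refine ⟨t, htadm, ?_⟩
  have h1 := CentreSeq.IsAdmissibleFor.support_transformMarked_subset_preimage t M htadm
  have h2 := CentreSeq.support_transformMarked_subset_compl_preimage_range t U.ι M hpb hs
  ext z
  simp only [Set.mem_empty_iff_false, iff_false]
  exact fun hz => h2 hz (hrange (h1 hz))

/-! ## §1 The snc end-game, at the data level -/

section EndGame

variable {X : Scheme.{u}} [IsIntegral X] [AlgebraicGeometry.IsNoetherian X]

/-- **THE SNC END-GAME, AT THE DATA LEVEL (any dimension).** `X` regular integral Noetherian excellent, `I ≠ 0` effective Cartier,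
`E` snc, `m ≥ 1`, `U ⊇ Sing(I, m)` open such that at every point of `U` the list of prime divisors of `V(I · ∏E)` is snc (`SNCAt`)
⟹ `∃ t : CentreSeq X, t.IsResolutionOf ⟨I, E, m⟩`. Proof = gen 6's `exists_isMarkedResolution_of_sncAt_nhds` with the data-level
§0: on `U`, `I|_U` is the monomial ideal of the restricted prime divisors of `J = I·∏E`; Kollár's monomial resolution (tree
`exists_isResolutionOf_monomialMarked`) resolves `(I|_U, all prime divisors|_U, m)`, hence `(I|_U, covered ones, m)` (sub-boundary), hence
`(I|_U, E|_U, m)` (equivalent boundary, gen 6 `boundaryEquiv_covered_primeDivisors`), and §0 extends it to `X`.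
[cite: Kollar2007, (3.111) Step 3] [cite: BierstoneGrigorievMilmanWlodarczyk2011, Def. 3.1.3] -/
theorem exists_isResolutionOf_of_sncAt_nhds (hX : Scheme.IsRegular X) (hXe : Scheme.IsExcellent X)
    {I : X.IdealSheafData} (hI : I ≠ ⊥) (hIc : IsEffectiveCartier I) {E : List X.IdealSheafData} (hE : HasSNC E)
    {m : ℕ} (hm : 1 ≤ m) (hJ : I * E.prod ≠ ⊥) (U : X.Opens) (hU : ∀ x : X, (m : ℕ∞) ≤ idealOrder I x → x ∈ (U : Set X))
    (hsnc : ∀ y ∈ (U : Set X), SNCAt (((finite_divisorialPoints hJ).toFinset.toList).map primeDivisorIdeal) y) :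
    ∃ t : CentreSeq X, t.IsResolutionOf (⟨I, E, m⟩ : MarkedIdeal X) := by
  classical
  haveI : IsLocallyNoetherian X := inferInstance
  haveI : IsLocallyNoetherian (U : Scheme.{u}) := LocallyOfFiniteType.isLocallyNoetherian U.ι
  set J := I * E.prod with hJdef
  have hJc : IsEffectiveCartier J := hIc.mul (HasSNC.isEffectiveCartier_prod hE)
  have hJp : IsLocallyPrincipal J := hJc.isLocallyPrincipal
  have hEJ : ∀ D ∈ E, J ≤ D := fun D hD =>
    le_trans (mul_le_of_le_one_left bot_le le_top) (IdealSheafData.prod_le_of_mem hD)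
  set T := (finite_divisorialPoints hJ).toFinset with hT
  have hTmem : ∀ ζ, ζ ∈ T ↔ ζ ∈ divisorialPoints J := fun ζ => by simp [hT]
  -- §A the monomial presentation of `I|_U` over the prime divisors of `J`
  set Ea : List ((U : Scheme.{u}).IdealSheafData × ℕ) :=
    T.toList.map fun ζ => ((primeDivisorIdeal ζ).comap U.ι, (idealOrder I ζ).toNat) with hEa
  have hEaX : Ea = (T.toList.map fun ζ => (primeDivisorIdeal ζ, (idealOrder I ζ).toNat)).map
      fun p => (p.1.comap U.ι, p.2) := by rw [hEa, List.map_map]; rfl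
  have hbdry : boundaryOf Ea = (T.toList.map primeDivisorIdeal).map fun D => D.comap U.ι := by
    rw [hEa, boundaryOf, List.map_map, List.map_map]; rfl
  have hideal : monomialIdeal Ea = I.comap U.ι := by
    rw [hEaX, ← comap_monomialIdeal_eq, monomialIdeal_divisorialPoints_of_subset hX hI hIc.isLocallyPrincipal T
      (fun ζ hζ => ((mem_divisorialPoints_iff J ζ).mp ((hTmem ζ).mp hζ)).2) ?_]
    intro ζ hζ
    rw [Finset.mem_coe, hTmem, mem_divisorialPoints_iff]
    obtain ⟨hζs, hζc⟩ := (mem_divisorialPoints_iff I ζ).mp hζ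
    exact ⟨Scheme.IdealSheafData.support_antitone (mul_le_of_le_one_right bot_le le_top : J ≤ I) hζs, hζc⟩
  have hEasnc : HasSNC (boundaryOf Ea) := by
    rw [hbdry]
    exact hasSNC_map_comap_ι_of_forall_sncAt _ U hsnc
  -- §B Kollár's monomial resolution on `U`, read for the covered sub-boundary, then for `E|_U`
  obtain ⟨s, hs⟩ := exists_isResolutionOf_monomialMarked Ea hEasnc hm
  have hs1 : s.IsResolutionOf ⟨I.comap U.ι, boundaryOf Ea, m⟩ := by
    rw [← hideal]; exact hs
  set Tc : List X := T.toList.filter fun ζ => ∃ D ∈ E, ζ ∈ D.support with hTc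
  have hTcmem : ∀ ζ, ζ ∈ Tc ↔ ζ ∈ divisorialPoints J ∧ ∃ D ∈ E, ζ ∈ D.support := fun ζ => by
    rw [hTc, List.mem_filter, Finset.mem_toList, hTmem, decide_eq_true_iff]
  have hsub : (Tc.map fun ζ => (primeDivisorIdeal ζ).comap U.ι).Sublist (boundaryOf Ea) := by
    rw [hbdry, List.map_map]
    exact List.Sublist.map _ List.filter_sublist
  have hs2 : s.IsResolutionOf ⟨I.comap U.ι, Tc.map fun ζ => (primeDivisorIdeal ζ).comap U.ι, m⟩ :=
    CentreSeq.IsResolutionOf.of_boundary_sublist s hsub hs1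
  have hs3 : s.IsResolutionOf ((⟨I, E, m⟩ : MarkedIdeal X).comap U.ι) :=
    CentreSeq.IsResolutionOf.of_boundaryEquiv s (boundaryEquiv_covered_primeDivisors hX hE hJ hJp hEJ U Tc hTcmem) hs2
  -- §C extend from `U ⊇ Sing(I, m)` to `X`
  exact exists_isResolutionOf_of_isResolutionOf_opens ⟨I, E, m⟩ hE (isClosed_setOf_le_idealOrder hX hXe hI m) U
    (fun x hx => hU x hx) hs3

end EndGame

/-! ## §2 The surface loop, at the data level -/

/-- **[OURS · W4.6 rung (i), host words] THE SURFACE LOOP WITH BOUNDARY, AT THE DATA LEVEL.** For a field `k`, `m ≥ 1` and a value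
`μ` of pv-11's measure: every regular integral Noetherian `k`-scheme `X` locally of finite type with `topologicalKrullDim X = 2`,
every effective Cartier `I ≠ 0`, every snc boundary `E` and every prime-divisor family of `V(I · ∏E)` of measure `μ` admit a
data-level resolution `t : CentreSeq X` of `(I, E, m)`. Well-founded induction on `μ ∈ ℕ∞ ×ₗ ℕ ×ₗ ℕ`; the step prepends the CHOSEN
blow-up `blowup.π P` of the non-snc point (`CentreSeq.cons`), the base is §1. Proof text = gen 6's `exists_isMarkedResolution_of_family`.
[cite: Hartshorne1977, Ch. V Thm. 3.9] [cite: BierstoneGrigorievMilmanWlodarczyk2011, Def. 3.1.3–3.1.4] -/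
theorem exists_isResolutionOf_of_family {k : Type u} [Field k] {m : ℕ} (hm : 1 ≤ m) (μ : ℕ∞ ×ₗ ℕ ×ₗ ℕ) :
    ∀ {ι : Type} [Finite ι] {X : Scheme.{u}} [IsIntegral X] [IsNoetherian X] (s : X ⟶ Spec (.of k))
      [LocallyOfFiniteType s] (_ : Scheme.IsRegular X) (_ : topologicalKrullDim X = 2) {I : X.IdealSheafData} (_ : I ≠ ⊥)
      (_ : IsEffectiveCartier I) {E : List X.IdealSheafData} (_ : HasSNC E) (hJ : I * E.prod ≠ ⊥)
      (ζ : ι → X) (C : ι → Scheme.{u}) (i : ∀ l, C l ⟶ X) (_ : Function.Injective ζ)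
      (_ : Set.range ζ = divisorialPoints (I * E.prod))
      (hfam : ∀ l, IsClosedImmersion (i l) ∧ ∃ (_ : IsIntegral (C l)) (_ : IsNoetherian (C l)),
        Scheme.IsQuasiExcellent (C l) ∧ topologicalKrullDim (C l) ≤ 1 ∧ i l (genericPoint (C l)) = ζ l),
      toLex (@familyDelta ι C (fun l => (hfam l).2.1), toLex (familyTangency ζ, familyExcess ζ)) = μ →
        ∃ t : CentreSeq X, t.IsResolutionOf (⟨I, E, m⟩ : MarkedIdeal X) := by
  induction μ using WellFoundedLT.induction with
  | ind μ ih =>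
  intro ι _ X _ _ s _ hX hd I hI hIc E hE hJ ζ C i hζinj hζrange hfam hμ
  haveI : IsLocallyNoetherian X := inferInstance
  have hdim : topologicalKrullDim X ≤ 2 := hd.le
  have hXe : Scheme.IsExcellent X := Scheme.isExcellent_of_locallyOfFiniteType Stacks07QW_field_holds s
  have hXq : Scheme.IsQuasiExcellent X := hXe.isQuasiExcellent
  by_cases hall : ∀ y : X, (m : ℕ∞) ≤ idealOrder I y →
      SNCAt (((finite_divisorialPoints hJ).toFinset.toList).map primeDivisorIdeal) y
  · /- END-GAME: `Supp J` is snc on an open neighbourhood of `Sing(I, m)` -/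
    obtain ⟨hFfin, hFcl⟩ := finite_setOf_not_sncAt_divisorial hX hXe hdim hJ
    have hFclosed : IsClosed {y : X | ¬ SNCAt (((finite_divisorialPoints hJ).toFinset.toList).map primeDivisorIdeal) y} := by
      rw [← Set.biUnion_of_singleton {y : X | ¬ SNCAt (((finite_divisorialPoints hJ).toFinset.toList).map primeDivisorIdeal) y}]
      exact hFfin.isClosed_biUnion fun y hy => hFcl y hy
    let U : X.Opens := ⟨{y : X | ¬ SNCAt (((finite_divisorialPoints hJ).toFinset.toList).map primeDivisorIdeal) y}ᶜ,
      hFclosed.isOpen_compl⟩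
    exact exists_isResolutionOf_of_sncAt_nhds hX hXe hI hIc hE hm hJ U (fun y hy h => h (hall y hy))
      fun y hy => by by_contra h; exact hy h
  · /- STEP: blow up a non-snc point of `Sing(I, m)` (the CHOSEN blow-up, `blowup.π P`) -/
    push Not at hall
    obtain ⟨x, hxm, hxsnc⟩ := hall
    have hx : IsClosed ({x} : Set X) := (finite_setOf_not_sncAt_divisorial hX hXe hdim hJ).2 x hxsnc
    have hR2 : ringKrullDim (X.presheaf.stalk x) = 2 := by rw [ringKrullDim_stalk_eq_of_isClosed s hx, hd]
    have hxne : ({x} : Set X) ≠ Set.univ := by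
      intro h
      have hgen : genericPoint X ∈ ({x} : Set X) := h ▸ Set.mem_univ _
      rw [Set.mem_singleton_iff] at hgen
      have h1 : (1 : ℕ∞) ≤ idealOrder I x := le_trans (by exact_mod_cast hm) hxm
      rw [← hgen] at h1
      exact not_mem_support_genericPoint hI ((mem_support_iff_one_le_idealOrder I _).mpr h1)
    set P : X.IdealSheafData := vanishingIdeal ⟨{x}, hx⟩ with hP
    -- the CHOSEN blow-up of `P`
    have hπ : IsBlowup (blowup.π P) P := blowup.isBlowup P
    -- the BGMW step
    have hPreg : Scheme.IsRegular P.subscheme := isRegular_subscheme_vanishingIdeal_singleton hx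
    have hPsupp : (P.support : Set X) ⊆ (⟨I, E, m⟩ : MarkedIdeal X).support := by
      intro y hy
      rw [hP, Scheme.IdealSheafData.coe_support_vanishingIdeal] at hy
      rw [show y = x from hy]
      exact hxm
    have hPsnc : HasSNCWith E P := HasSNC.hasSNCWith_vanishingIdeal_singleton hE hx
    -- the new surface
    haveI : IsIntegral (blowup P) := hπ.isIntegral (vanishingIdeal_singleton_ne_bot hx hxne)
    haveI : IsProper (blowup.π P) := hπ.isProper
    haveI : IsLocallyNoetherian (blowup P) := LocallyOfFiniteType.isLocallyNoetherian (blowup.π P)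
    haveI : CompactSpace (blowup P) := QuasiCompact.compactSpace_of_compactSpace (blowup.π P)
    haveI : IsNoetherian (blowup P) := {}
    have hX' : Scheme.IsRegular (blowup P) := hπ.isRegular_of_isRegular_subscheme hX hPreg
    have hd' : topologicalKrullDim (blowup P) = 2 := by
      rw [← hd]
      exact (hπ.isBirational' (vanishingIdeal_singleton_ne_bot hx hxne)).topologicalKrullDim_eq_of_isProper
    -- the new marked ideal `(I′, E′, m)` and its ideal `J′ = I′ ∏E′ = τᶜ(J, m + s − 1)`
    obtain ⟨hI', hIc'⟩ := controlledTransform_ne_bot_and_isEffectiveCartier_point hX hx hxne hπ hI hIc hxm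
    have hE' : HasSNC ((⟨I, E, m⟩ : MarkedIdeal X).transform (blowup.π P) P).boundary :=
      MarkedIdeal.hasSNC_transform_boundary _ hPsnc hπ
    have hIC : I ≤ P ^ m :=
      le_vanishingIdeal_pow_of_forall_le_idealOrder hX hPreg fun y hy => by rw [show y = x from hy]; exact hxm
    have hη : IsGenericPoint x (P.support : Set X) := by
      rw [hP, Scheme.IdealSheafData.coe_support_vanishingIdeal]
      exact hx.closure_eq
    have hint : interior (P.support : Set X) = ∅ := by
      rw [hP, Scheme.IdealSheafData.coe_support_vanishingIdeal]; exact interior_singleton_eq_empty hx hxne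
    have hEc : ∀ D ∈ E, IsEffectiveCartier D := fun D hD => HasSNC.isEffectiveCartier_of_mem hE hD
    have hEne : ∀ D ∈ E, D ≠ ⊥ := fun D hD => HasSNC.ne_bot_of_mem hE hD
    have hJ'eq := controlledTransform_mul_prod_eq hX hPreg hη hint hπ hm hIC E hEc hEne
    set μ' := m + (E.map fun D => (idealOrder D x).toNat).sum - 1 with hμ'
    obtain ⟨ι', hfinι', ζ', C', i', hfam', hinj', hrange', hlt⟩ :=
      exists_family_measure_lt hX hXq hdim hx hxne hR2 hπ hJ μ' ζ C i hζinj hζrange hfam hxsnc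
    rw [hJ'eq] at hrange'
    -- an effective Cartier ideal on a non-empty scheme is `≠ ⊥`
    have hne : ∀ {W : Scheme.{u}} [Nonempty W] {K : W.IdealSheafData}, IsEffectiveCartier K → K ≠ ⊥ := by
      intro W _ K hK h0
      obtain ⟨U, hxU, g, hg, hU⟩ := hK (Classical.arbitrary W)
      rw [h0, Scheme.IdealSheafData.ideal_bot, Pi.bot_apply, eq_comm, Ideal.span_singleton_eq_bot] at hU
      subst hU
      haveI : Nonempty (U : W.Opens) := ⟨⟨_, hxU⟩⟩
      exact zero_notMem_nonZeroDivisors hg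
    have hJ' : controlledTransform (blowup.π P) P I m *
        (E.map (strictTransformIdeal (blowup.π P) P) ++ [P.comap (blowup.π P)]).prod ≠ ⊥ :=
      hne (hIc'.mul (HasSNC.isEffectiveCartier_prod hE'))
    haveI := hfinι'
    obtain ⟨t', ht'⟩ := ih _ (hμ ▸ hlt) (blowup.π P ≫ s) hX' hd' hI' hIc' hE' hJ' ζ' C' i' hinj' hrange' hfam' rfl
    exact ⟨CentreSeq.cons P t', (CentreSeq.isAdmissibleFor_cons P t' _).mpr ⟨hPsupp, hPsnc, hPreg, ht'.1⟩, ht'.2⟩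

/-! ## §3 Curves, and the surface theorem -/

/-- **CURVES, AT THE DATA LEVEL, EVERY IDEAL** (no base field): `X` integral Noetherian regular of `topologicalKrullDim ≤ 1`,
`I ≠ 0` ANY ideal sheaf, `E` snc (which carries the regularity of `X`), `m ≥ 1` ⟹ `∃ t : CentreSeq X, t.IsResolutionOf ⟨I, E, m⟩`
— res-L1-s46-pv-7's order reduction for marked ideals in dimension one (`exists_isResolutionOf_of_ringKrullDim_le_one`, every
characteristic) fed with: `Sing(I, m) ⊆ V(I)` is a finite set of closed points (a proper closed subset of an integral Noetherian scheme
of dimension `≤ 1`), the local rings have dimension `≤ dim X ≤ 1`, and `I_x ≠ 0`. [cite: Kollar2007, Thm. 3.69, 3.111 Step 1]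
[cite: BierstoneGrigorievMilmanWlodarczyk2011, Def. 3.1.3] -/
theorem exists_isResolutionOf_of_dim_le_one {X : Scheme.{u}} [IsIntegral X] [IsNoetherian X]
    (hdim : topologicalKrullDim X ≤ 1) {I : X.IdealSheafData} (hI : I ≠ ⊥) {E : List X.IdealSheafData} (hE : HasSNC E)
    {m : ℕ} (hm : 1 ≤ m) : ∃ t : CentreSeq X, t.IsResolutionOf (⟨I, E, m⟩ : MarkedIdeal X) := by
  haveI : IsLocallyNoetherian X := inferInstance
  have hS_sub : (⟨I, E, m⟩ : MarkedIdeal X).support ⊆ (I.support : Set X) := by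
    intro y hy
    have h1 : (1 : ℕ∞) ≤ idealOrder I y := le_trans (by exact_mod_cast hm) hy
    exact (one_le_idealOrder_iff I y).mp h1
  have hsupp_ne : (I.support : Set X) ≠ Set.univ := by
    intro h
    apply hI
    rw [← support_eq_top_iff]
    exact Closeds.ext (by simpa using h)
  obtain ⟨hf, hcl⟩ := Set.finite_and_isClosed_singleton_of_dim_le_one hdim I.support.isClosed hsupp_ne
  refine exists_isResolutionOf_of_ringKrullDim_le_one ⟨I, E, m⟩ hm hE (hf.subset hS_sub) (fun x hx => hcl x (hS_sub hx))
    (fun x _ => ?_) fun x _ => stalkIdeal_ne_bot_of_ne_bot hI x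
  exact (ringKrullDim_stalk_le_topologicalKrullDim X x).trans hdim

/-- **[OURS · W4.6 rung (i), host words] MARKED ORDER REDUCTION OF EFFECTIVE CARTIER MARKED IDEALS ON REGULAR SURFACES, AT THE DATA
LEVEL** (universe polymorphic; every field). For a field `k`, an integral Noetherian regular `k`-scheme `X` locally of finite type with
`topologicalKrullDim X ≤ 2`, an effective Cartier ideal `I ≠ 0`, an snc boundary `E` and `m ≥ 1`:
`∃ t : CentreSeq X, t.IsResolutionOf ⟨I, E, m⟩` — a data-level BGMW resolution (regular centres inside the successive supports, snc
with the successive boundaries, final support empty). Dimension `≤ 1`: `exists_isResolutionOf_of_dim_le_one`; dimension `2`: the loop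
`exists_isResolutionOf_of_family` entered through pv-11's brick B10a. Through the tree's `CentreSeq.IsResolutionOf.isMarkedResolution` it
re-proves gen 6's `hypersurfaceOrderReduction_of_dim_le_two`. [cite: Hartshorne1977, Ch. V Thm. 3.9]
[cite: BierstoneGrigorievMilmanWlodarczyk2011, Def. 3.1.3–3.1.4] -/
theorem exists_isResolutionOf_of_isEffectiveCartier {k : Type u} [Field k] (X : Scheme.{u}) (s : X ⟶ Spec (.of k))
    [LocallyOfFiniteType s] [IsIntegral X] [IsNoetherian X] (hreg : Scheme.IsRegular X) (hdim : topologicalKrullDim X ≤ 2)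
    (I : X.IdealSheafData) (hI : I ≠ ⊥) (hIc : IsEffectiveCartier I) (E : List X.IdealSheafData) (hE : HasSNC E)
    (m : ℕ) (hm : 1 ≤ m) : ∃ t : CentreSeq X, t.IsResolutionOf (⟨I, E, m⟩ : MarkedIdeal X) := by
  haveI : IsLocallyNoetherian X := inferInstance
  by_cases hd1 : topologicalKrullDim X ≤ 1
  · exact exists_isResolutionOf_of_dim_le_one hd1 hI hE hm
  · have hd : topologicalKrullDim X = 2 := withBotENat_eq_two hdim hd1
    have hXe : Scheme.IsExcellent X := Scheme.isExcellent_of_locallyOfFiniteType Stacks07QW_field_holds s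
    -- an effective Cartier ideal on a non-empty scheme is `≠ ⊥`
    have hne : ∀ {W : Scheme.{u}} [Nonempty W] {K : W.IdealSheafData}, IsEffectiveCartier K → K ≠ ⊥ := by
      intro W _ K hK h0
      obtain ⟨U, hxU, g, hg, hU⟩ := hK (Classical.arbitrary W)
      rw [h0, Scheme.IdealSheafData.ideal_bot, Pi.bot_apply, eq_comm, Ideal.span_singleton_eq_bot] at hU
      subst hU
      haveI : Nonempty (U : W.Opens) := ⟨⟨_, hxU⟩⟩
      exact zero_notMem_nonZeroDivisors hg
    have hJ : I * E.prod ≠ ⊥ := hne (hIc.mul (HasSNC.isEffectiveCartier_prod hE))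
    obtain ⟨n, ζ, C, i, hζinj, hζrange, hfam⟩ := exists_primeDivisorFamily hXe.isQuasiExcellent hdim hJ
    exact exists_isResolutionOf_of_family hm _ s hreg hd hI hIc hE hJ ζ C i hζinj hζrange hfam rfl

end CampaignW46

end Summit.ResolutionOfSingularities.ResolutionOfSingularities.Theorems

end
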